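import Mathlib.Analysis.InnerProductSpace.Projection.Submodule
import Mathlib.Order.Zorn

/-!
# T5IsotypicHilbertSum — Hilbert-sum bookkeeping behind the isotypic decomposition

Kernel forms of the abstract Hilbert-space sentences of route/T5-N4-p5.md v12 (A3) STEPS 3 (δ),
4 and 5 and (A4)(2) (cell pub-hodge-repro2, seat p5).  Everything here is about an inner product
space `E` over `𝕜` (`RCLike 𝕜`), its submodules, orthogonal complements `Kᗮ`, topological closures
and orthogonal projections; NOTHING about groups, representations, `L²([U(W_A)])`, the subspaces
`L_π` as G_∞-isotypic parts, or the printed theorems ([Bo72] 5.4–5.5, [KV] 0.2–0.4, [BW] VII 3.1)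
is asserted — those remain the prose's cited inputs.

Dictionary (prose ↦ kernel):
* STEP 3 (δ) «take a maximal family of mutually orthogonal closed subspaces ≅ π inside L_π (Zorn)»
  ↦ `exists_maximal_pairwise_isOrtho` (for ANY property `P` of subspaces);
* STEP 3 (δ) «if the orthogonal complement L′ of the family inside L_π were non-zero, one of the
  generating copies W would not be orthogonal to L′» ↦ `exists_not_isOrtho_of_ne_bot`
  (contrapositive `eq_bot_of_le_closure_sSup_of_forall_isOrtho`, indexed form
  `eq_bot_of_le_closure_iSup_of_forall_isOrtho`);
* STEP 3 (γ) «each L^{K_f} ⊂ ⊕̂_π L_π and ∪ L^{K_f} is dense in L, hence L = ⊕̂_π L_π»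
  ↦ `closure_eq_top_of_forall_le_of_dense`;
* STEP 4 «v = Σ_π P_π v = P_{π_∞} v for v ∈ π₀, hence π₀ ⊂ L_{π_∞}» ↦
  `starProjection_eq_self_of_forall_ne`, `mem_of_forall_ne`, `le_of_forall_ne`, and the existence
  half of «exactly one π_∞ has A_{π_∞} ≠ 0» ↦ `exists_starProjection_ne_zero`;
* STEP 5 «L_{π_∞} ∩ L^{K_f} = m_{K_f}(π_∞) H_{π_∞}» ↦ `inf_closure_iSup_eq` (the closed span `M` of
  subspaces `N i ≤ L i` meets the closed `L i₀` exactly in the closure of `N i₀`);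
* (A4)(2) «N̄ is G_∞-stable (limits of G_∞-stable sequences)» ↦ `map_topologicalClosure_le`,
  «each closure(N^{K′_f}) ⊂ N̄ is G_∞-stable and N = ∪ N^{K′_f}» ↦ `map_topologicalClosure_le_of_iSup`,
  «π₀^{K′_f} = e_{K′_f}(N̄) ⊂ closure(e_{K′_f} N) = closure(N^{K′_f})» ↦
  `range_le_closure_inf_range_of_dense` (for a continuous `e` and a dense `e`-stable `N`; the range
  of an idempotent continuous `e` is closed: `isClosed_range_of_idempotent`).
-/

noncomputable section

open Submodule Topology

namespace Summit.Ventures.HodgeRepro2.T5IsotypicHilbertSum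

variable {𝕜 E : Type*} [RCLike 𝕜] [NormedAddCommGroup E] [InnerProductSpace 𝕜 E]

/-! ### Orthogonality to a generating family -/

/-- (A3) STEP 3 (δ), indexed form: a subspace `L'` of the closed span of a family `W` that is
orthogonal to every member of the family is zero. -/
theorem eq_bot_of_le_closure_iSup_of_forall_isOrtho {ι : Type*} (W : ι → Submodule 𝕜 E)
    (L' : Submodule 𝕜 E) (hle : L' ≤ (iSup W).topologicalClosure)
    (horth : ∀ i, L' ⟂ W i) : L' = ⊥ := by
  have h1 : L' ≤ (iSup W).topologicalClosureᗮ := by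
    rw [Submodule.orthogonal_closure, ← Submodule.iInf_orthogonal]
    exact le_iInf fun i => (horth i).le
  have h2 : L' ≤ (iSup W).topologicalClosure ⊓ (iSup W).topologicalClosureᗮ := le_inf hle h1
  rwa [Submodule.inf_orthogonal_eq_bot, le_bot_iff] at h2

/-- (A3) STEP 3 (δ), set form: a subspace `L'` of the closed span of a set `S` of subspaces that is
orthogonal to every member of `S` is zero. -/
theorem eq_bot_of_le_closure_sSup_of_forall_isOrtho (S : Set (Submodule 𝕜 E))
    (L' : Submodule 𝕜 E) (hle : L' ≤ (sSup S).topologicalClosure)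
    (horth : ∀ W ∈ S, L' ⟂ W) : L' = ⊥ := by
  have h1 : L' ≤ (sSup S).topologicalClosureᗮ := by
    rw [Submodule.orthogonal_closure, ← Submodule.sInf_orthogonal]
    exact le_iInf₂ fun W hW => (horth W hW).le
  have h2 : L' ≤ (sSup S).topologicalClosure ⊓ (sSup S).topologicalClosureᗮ := le_inf hle h1
  rwa [Submodule.inf_orthogonal_eq_bot, le_bot_iff] at h2

/-- (A3) STEP 3 (δ): if a NON-ZERO subspace `L'` lies in the closed span of a set `S` of subspaces,
then `L'` fails to be orthogonal to at least one member of `S` — i.e. the orthogonal projection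
onto `L'` of some generating `W ∈ S` is non-zero. -/
theorem exists_not_isOrtho_of_ne_bot (S : Set (Submodule 𝕜 E)) (L' : Submodule 𝕜 E)
    (hle : L' ≤ (sSup S).topologicalClosure) (hne : L' ≠ ⊥) : ∃ W ∈ S, ¬ L' ⟂ W := by
  by_contra h
  refine hne (eq_bot_of_le_closure_sSup_of_forall_isOrtho S L' hle fun W hW => ?_)
  by_contra hc
  exact h ⟨W, hW, hc⟩

/-! ### The Zorn step -/

/-- (A3) STEP 3 (δ), the Zorn step: for any property `P` of subspaces there is a MAXIMAL set of
pairwise-orthogonal subspaces all satisfying `P` (maximal among all such sets, for inclusion). -/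
theorem exists_maximal_pairwise_isOrtho (P : Submodule 𝕜 E → Prop) :
    ∃ S : Set (Submodule 𝕜 E),
      Maximal (fun T : Set (Submodule 𝕜 E) =>
        (∀ U ∈ T, P U) ∧ T.Pairwise (fun U V => U ⟂ V)) S := by
  apply zorn_subset
  intro c hc hchain
  refine ⟨⋃₀ c, ⟨?_, ?_⟩, fun s hs => Set.subset_sUnion_of_mem hs⟩
  · rintro U ⟨s, hs, hU⟩
    exact (hc hs).1 U hU
  · rintro U ⟨s, hs, hU⟩ V ⟨t, ht, hV⟩ hUV
    rcases hchain.total hs ht with h | h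
    · exact (hc ht).2 (h hU) hV hUV
    · exact (hc hs).2 hU (h hV) hUV

/-- The maximal family of `exists_maximal_pairwise_isOrtho` cannot be enlarged: a subspace
satisfying `P` and orthogonal to every member of the family already belongs to it (in the prose,
a further copy of `π` orthogonal to the family contradicts maximality). -/
theorem mem_of_maximal_pairwise_isOrtho {P : Submodule 𝕜 E → Prop} {S : Set (Submodule 𝕜 E)}
    (hS : Maximal (fun T : Set (Submodule 𝕜 E) =>
      (∀ U ∈ T, P U) ∧ T.Pairwise (fun U V => U ⟂ V)) S)
    {W : Submodule 𝕜 E} (hW : P W) (horth : ∀ U ∈ S, W ⟂ U) : W ∈ S := by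
  apply hS.mem_of_prop_insert
  refine ⟨?_, ?_⟩
  · rintro U (rfl | hU)
    · exact hW
    · exact hS.prop.1 U hU
  · rintro U (rfl | hU) V (rfl | hV) hUV
    · exact absurd rfl hUV
    · exact horth V hV
    · exact (horth U hU).symm
    · exact hS.prop.2 hU hV hUV

/-! ### Density and the Hilbert-sum decomposition -/

/-- (A3) STEP 3 (γ): if every member of a family `M j` of subspaces lies in a closed subspace `C`
and the family spans a dense subspace, then `C = ⊤` («each L^{K_f} ⊂ ⊕̂_π L_π and ∪ L^{K_f} is
dense, hence L = ⊕̂_π L_π»). -/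
theorem closure_eq_top_of_forall_le_of_dense {κ : Type*} (M : κ → Submodule 𝕜 E)
    (C : Submodule 𝕜 E) (hC : IsClosed (C : Set E)) (hle : ∀ j, M j ≤ C)
    (hdense : (iSup M).topologicalClosure = ⊤) : C = ⊤ := by
  apply top_le_iff.mp
  rw [← hdense]
  exact (iSup M).topologicalClosure_minimal (iSup_le hle) hC

/-- (A3) STEP 4: let the subspaces `L i` be pairwise orthogonal with dense sum. A vector `v`
orthogonal to every `L j`, `j ≠ i₀`, equals its orthogonal projection onto `L i₀`
(«v = Σ_π P_π v = P_{π_∞} v»). -/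
theorem starProjection_eq_self_of_forall_ne {ι : Type*} (L : ι → Submodule 𝕜 E)
    (hpair : Pairwise fun i j => L i ⟂ L j) (hdense : (iSup L).topologicalClosure = ⊤)
    (i₀ : ι) [(L i₀).HasOrthogonalProjection] {v : E} (hv : ∀ j, j ≠ i₀ → v ∈ (L j)ᗮ) :
    (L i₀).starProjection v = v := by
  have hw0 : v - (L i₀).starProjection v ∈ (L i₀)ᗮ :=
    (L i₀).sub_starProjection_mem_orthogonal v
  have hwj : ∀ j, v - (L i₀).starProjection v ∈ (L j)ᗮ := by
    intro j
    by_cases hj : j = i₀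
    · subst hj; exact hw0
    · have h1 : (L i₀).starProjection v ∈ (L j)ᗮ :=
        (hpair (Ne.symm hj)).le ((L i₀).starProjection_apply_mem v)
      exact Submodule.sub_mem _ (hv j hj) h1
  have hw : v - (L i₀).starProjection v ∈ (iSup L)ᗮ := by
    rw [← Submodule.iInf_orthogonal]
    exact (Submodule.mem_iInf _).mpr hwj
  rw [← Submodule.orthogonal_closure, hdense, Submodule.top_orthogonal_eq_bot,
    Submodule.mem_bot, sub_eq_zero] at hw
  exact hw.symm

/-- (A3) STEP 4, membership form: under the hypotheses of `starProjection_eq_self_of_forall_ne`,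
`v ∈ L i₀`. -/
theorem mem_of_forall_ne {ι : Type*} (L : ι → Submodule 𝕜 E)
    (hpair : Pairwise fun i j => L i ⟂ L j) (hdense : (iSup L).topologicalClosure = ⊤)
    (i₀ : ι) [(L i₀).HasOrthogonalProjection] {v : E} (hv : ∀ j, j ≠ i₀ → v ∈ (L j)ᗮ) :
    v ∈ L i₀ := by
  rw [← starProjection_eq_self_of_forall_ne L hpair hdense i₀ hv]
  exact (L i₀).starProjection_apply_mem v

/-- (A3) STEP 4, subspace form: a subspace `N` orthogonal to every `L j`, `j ≠ i₀`, is contained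
in `L i₀` («π₀ ⊂ L_{π_∞}»). -/
theorem le_of_forall_ne {ι : Type*} (L : ι → Submodule 𝕜 E)
    (hpair : Pairwise fun i j => L i ⟂ L j) (hdense : (iSup L).topologicalClosure = ⊤)
    (i₀ : ι) [(L i₀).HasOrthogonalProjection] {N : Submodule 𝕜 E}
    (hN : ∀ j, j ≠ i₀ → N ⟂ L j) : N ≤ L i₀ :=
  fun _ hv => mem_of_forall_ne L hpair hdense i₀ fun j hj => (hN j hj).le hv

/-- (A3) STEP 4, the existence half of «exactly one π_∞ has A_{π_∞} ≠ 0»: if the `L i` have dense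
sum, a non-zero vector has a non-zero orthogonal projection onto some `L i`. -/
theorem exists_starProjection_ne_zero {ι : Type*} (L : ι → Submodule 𝕜 E)
    [∀ i, (L i).HasOrthogonalProjection] (hdense : (iSup L).topologicalClosure = ⊤)
    {v : E} (hv : v ≠ 0) : ∃ i, (L i).starProjection v ≠ 0 := by
  by_contra h
  have h' : ∀ i, (L i).starProjection v = 0 := fun i => not_not.mp (not_exists.mp h i)
  have hmem : v ∈ (iSup L)ᗮ := by
    rw [← Submodule.iInf_orthogonal]
    exact (Submodule.mem_iInf _).mpr fun i => (L i).starProjection_apply_eq_zero_iff.mp (h' i)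
  rw [← Submodule.orthogonal_closure, hdense, Submodule.top_orthogonal_eq_bot,
    Submodule.mem_bot] at hmem
  exact hv hmem

/-- (A3) STEP 5: let the subspaces `L i` be pairwise orthogonal, `N i ≤ L i` for every `i`, and
`M` the closed span of the `N i`. If `L i₀` is closed (`E` complete), then
`L i₀ ⊓ M = closure (N i₀)` («L_{π_∞} ∩ L^{K_f} = m_{K_f}(π_∞) H_{π_∞}», the right side being the
closed subspace `N i₀` itself when `N i₀` is closed). -/
theorem inf_closure_iSup_eq [CompleteSpace E] {ι : Type*} (L N : ι → Submodule 𝕜 E)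
    (hpair : Pairwise fun i j => L i ⟂ L j) (hN : ∀ i, N i ≤ L i) (i₀ : ι)
    (hclosed : IsClosed (L i₀ : Set E)) :
    L i₀ ⊓ (iSup N).topologicalClosure = (N i₀).topologicalClosure := by
  have hCL : (N i₀).topologicalClosure ≤ L i₀ :=
    (N i₀).topologicalClosure_minimal (hN i₀) hclosed
  have hCM : (N i₀).topologicalClosure ≤ (iSup N).topologicalClosure :=
    Submodule.topologicalClosure_mono (le_iSup N i₀)
  refine le_antisymm ?_ (le_inf hCL hCM)
  rintro v ⟨hvL, hvM⟩
  have hPv : (N i₀).topologicalClosure.starProjection v ∈ (N i₀).topologicalClosure :=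
    (N i₀).topologicalClosure.starProjection_apply_mem v
  have hw0 : v - (N i₀).topologicalClosure.starProjection v ∈ (N i₀).topologicalClosureᗮ :=
    (N i₀).topologicalClosure.sub_starProjection_mem_orthogonal v
  have hwj : ∀ j, v - (N i₀).topologicalClosure.starProjection v ∈ (N j)ᗮ := by
    intro j
    by_cases hj : j = i₀
    · subst hj
      rw [← Submodule.orthogonal_closure]
      exact hw0
    · have h1 : v ∈ (N j)ᗮ :=
        Submodule.orthogonal_le (hN j) ((hpair (Ne.symm hj)).le hvL)
      have h2 : (N i₀).topologicalClosure.starProjection v ∈ (N j)ᗮ :=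
        Submodule.orthogonal_le (hN j) ((hpair (Ne.symm hj)).le (hCL hPv))
      exact Submodule.sub_mem _ h1 h2
  have hw : v - (N i₀).topologicalClosure.starProjection v ∈ (iSup N).topologicalClosureᗮ := by
    rw [Submodule.orthogonal_closure, ← Submodule.iInf_orthogonal]
    exact (Submodule.mem_iInf _).mpr hwj
  have hwM : v - (N i₀).topologicalClosure.starProjection v ∈ (iSup N).topologicalClosure :=
    Submodule.sub_mem _ hvM (hCM hPv)
  have hzero : v - (N i₀).topologicalClosure.starProjection v ∈
      (iSup N).topologicalClosure ⊓ (iSup N).topologicalClosureᗮ := ⟨hwM, hw⟩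
  rw [Submodule.inf_orthogonal_eq_bot, Submodule.mem_bot, sub_eq_zero] at hzero
  rw [hzero]
  exact hPv

/-- (A3) STEP 5 with `N i₀` closed: `L i₀ ⊓ M = N i₀`. -/
theorem inf_closure_iSup_eq_of_isClosed [CompleteSpace E] {ι : Type*} (L N : ι → Submodule 𝕜 E)
    (hpair : Pairwise fun i j => L i ⟂ L j) (hN : ∀ i, N i ≤ L i) (i₀ : ι)
    (hclosed : IsClosed (L i₀ : Set E)) (hNclosed : IsClosed (N i₀ : Set E)) :
    L i₀ ⊓ (iSup N).topologicalClosure = N i₀ := by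
  rw [inf_closure_iSup_eq L N hpair hN i₀ hclosed, hNclosed.submodule_topologicalClosure_eq]

/-! ### Closures of stable subspaces ((A4)(2)) -/

/-- (A4)(2): a continuous linear map `T` that preserves a subspace `N` preserves its closure
(«N̄ is G_∞-stable: limits of G_∞-stable sequences»). -/
theorem map_topologicalClosure_le (T : E →L[𝕜] E) (N : Submodule 𝕜 E)
    (h : N.map (T : E →ₗ[𝕜] E) ≤ N) :
    N.topologicalClosure.map (T : E →ₗ[𝕜] E) ≤ N.topologicalClosure := by
  rintro _ ⟨x, hx, rfl⟩
  have hsub : T '' (N : Set E) ⊆ (N : Set E) := by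
    rintro _ ⟨y, hy, rfl⟩
    exact h (Submodule.mem_map_of_mem hy)
  have hx' : T x ∈ closure (T '' (N : Set E)) :=
    image_closure_subset_closure_image T.continuous ⟨x, hx, rfl⟩
  exact closure_mono hsub hx'

/-- (A4)(2): if `N` is the sum of a family of subspaces `N i` each of whose closures is preserved
by the continuous linear map `T`, then the closure of `N` is preserved by `T`
(«N = ∪_{K′_f} N^{K′_f}, each closure(N^{K′_f}) ⊂ N̄ is G_∞-stable»). -/
theorem map_topologicalClosure_le_of_iSup {κ : Type*} (T : E →L[𝕜] E) (N : κ → Submodule 𝕜 E)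
    (h : ∀ i, (N i).topologicalClosure.map (T : E →ₗ[𝕜] E) ≤ (N i).topologicalClosure) :
    (iSup N).topologicalClosure.map (T : E →ₗ[𝕜] E) ≤ (iSup N).topologicalClosure := by
  have hle : (⨆ i, (N i).topologicalClosure) ≤ (iSup N).topologicalClosure :=
    iSup_le fun i => Submodule.topologicalClosure_mono (le_iSup N i)
  have hN : (iSup N).topologicalClosure = (⨆ i, (N i).topologicalClosure).topologicalClosure :=
    le_antisymm
      (Submodule.topologicalClosure_mono
        (iSup_le fun i => (le_iSup (fun i => (N i).topologicalClosure) i).trans'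
          (N i).le_topologicalClosure))
      ((⨆ i, (N i).topologicalClosure).topologicalClosure_minimal hle
        (iSup N).isClosed_topologicalClosure)
  rw [hN]
  apply map_topologicalClosure_le
  rw [Submodule.map_iSup]
  exact iSup_le fun i => ((h i).trans (le_iSup (fun i => (N i).topologicalClosure) i))

/-- (A4)(2): for a continuous linear map `e` and a DENSE subspace `N` preserved by `e`, the range
of `e` lies in the closure of `N ⊓ range e`
(«π₀^{K′_f} = e_{K′_f}(N̄) ⊂ closure(e_{K′_f} N) = closure(N^{K′_f})», with `range e` the fixed
subspace `π₀^{K′_f}` of the level projection and `N ⊓ range e = N^{K′_f}`). -/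
theorem range_le_closure_inf_range_of_dense (e : E →L[𝕜] E)
    (N : Submodule 𝕜 E) (hstable : N.map (e : E →ₗ[𝕜] E) ≤ N)
    (hdense : N.topologicalClosure = ⊤) :
    LinearMap.range (e : E →ₗ[𝕜] E) ≤ (N ⊓ LinearMap.range (e : E →ₗ[𝕜] E)).topologicalClosure := by
  rintro _ ⟨x, rfl⟩
  have hx : x ∈ N.topologicalClosure := by rw [hdense]; exact Submodule.mem_top
  have h1 : e x ∈ closure (e '' (N : Set E)) :=
    image_closure_subset_closure_image e.continuous ⟨x, hx, rfl⟩
  have hsub : e '' (N : Set E) ⊆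
      ((N ⊓ LinearMap.range (e : E →ₗ[𝕜] E) : Submodule 𝕜 E) : Set E) := by
    rintro _ ⟨y, hy, rfl⟩
    exact ⟨hstable (Submodule.mem_map_of_mem hy), ⟨y, rfl⟩⟩
  exact closure_mono hsub h1

/-- (A4)(2), the equality: if moreover the closure of `N ⊓ range e` lies in `range e` (e.g. because
`range e` is closed), then `closure (N ⊓ range e) = range e` («W = π₀^{K′_f}»). -/
theorem closure_inf_range_eq_of_dense (e : E →L[𝕜] E)
    (N : Submodule 𝕜 E) (hstable : N.map (e : E →ₗ[𝕜] E) ≤ N) (hdense : N.topologicalClosure = ⊤)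
    (hclosed : IsClosed ((LinearMap.range (e : E →ₗ[𝕜] E) : Submodule 𝕜 E) : Set E)) :
    (N ⊓ LinearMap.range (e : E →ₗ[𝕜] E)).topologicalClosure = LinearMap.range (e : E →ₗ[𝕜] E) :=
  le_antisymm
    ((N ⊓ LinearMap.range (e : E →ₗ[𝕜] E)).topologicalClosure_minimal inf_le_right hclosed)
    (range_le_closure_inf_range_of_dense e N hstable hdense)

/-- The range of an idempotent continuous linear map is closed (it is the kernel of `1 - e`). -/
theorem isClosed_range_of_idempotent (e : E →L[𝕜] E) (he : ∀ x, e (e x) = e x) :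
    IsClosed ((LinearMap.range (e : E →ₗ[𝕜] E) : Submodule 𝕜 E) : Set E) := by
  have hker : ((LinearMap.range (e : E →ₗ[𝕜] E) : Submodule 𝕜 E) : Set E) = {x | x - e x = 0} := by
    ext x
    constructor
    · rintro ⟨y, rfl⟩
      simp [he y]
    · intro hx
      exact ⟨x, (sub_eq_zero.mp hx).symm⟩
  rw [hker]
  exact isClosed_eq (continuous_id.sub e.continuous) continuous_const


/-! ### v2 (append-only): (A3) STEP 3 (α) — the closed span of a `T`-stable set of subspaces is
`T`-stable

«L_π is G(𝔸_f)-stable: R(g), g ∈ G(𝔸_f), commutes with G_∞ and maps such subspaces to such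
subspaces» ↦ `map_topologicalClosure_sSup_le` (a continuous linear `T` carrying every member of a
set `𝒮` of subspaces into the span of `𝒮` preserves the closed span), `map_map_le_of_comm` (a `T`
commuting with every `ρ g` carries `ρ`-stable subspaces to `ρ`-stable subspaces),
`isClosed_map_linearIsometry` (a linear isometry of a complete space carries closed subspaces to
closed subspaces) and `exists_linearIsometryEquiv_map_of_comm` (for a linear isometry `U` commuting
with the `ρ g`, the restriction `W ≃ₗᵢ U(W)` intertwines `ρ|_W` with `ρ|_{U(W)}` — «R(g) maps a
copy of π to a copy of π»). -/

/-- (A3) STEP 3 (α): if a continuous linear map `T` carries every member of a set `𝒮` of subspaces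
into the span of `𝒮`, then `T` preserves the closed span of `𝒮`. -/
theorem map_topologicalClosure_sSup_le (T : E →L[𝕜] E) (𝒮 : Set (Submodule 𝕜 E))
    (h : ∀ W ∈ 𝒮, W.map (T : E →ₗ[𝕜] E) ≤ sSup 𝒮) :
    (sSup 𝒮).topologicalClosure.map (T : E →ₗ[𝕜] E) ≤ (sSup 𝒮).topologicalClosure := by
  apply map_topologicalClosure_le
  rw [Submodule.map_le_iff_le_comap]
  exact sSup_le fun W hW => Submodule.map_le_iff_le_comap.mp (h W hW)

/-- A continuous linear map `T` commuting with every `ρ g` carries a `ρ`-stable subspace `W` to the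
`ρ`-stable subspace `T(W)`. -/
theorem map_map_le_of_comm {ι : Type*} (T : E →L[𝕜] E) (ρ : ι → E →L[𝕜] E)
    (hT : ∀ g, T ∘L ρ g = ρ g ∘L T) (W : Submodule 𝕜 E)
    (hW : ∀ g, W.map (ρ g : E →ₗ[𝕜] E) ≤ W) (g : ι) :
    (W.map (T : E →ₗ[𝕜] E)).map (ρ g : E →ₗ[𝕜] E) ≤ W.map (T : E →ₗ[𝕜] E) := by
  rintro _ ⟨_, ⟨w, hw, rfl⟩, rfl⟩
  refine ⟨ρ g w, hW g ⟨w, hw, rfl⟩, ?_⟩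
  have := congrArg (fun S : E →L[𝕜] E => S w) (hT g)
  simp only [ContinuousLinearMap.comp_apply] at this
  exact this

/-- A linear isometry of a complete space carries closed subspaces to closed subspaces. -/
theorem isClosed_map_linearIsometry [CompleteSpace E] (U : E →ₗᵢ[𝕜] E) (W : Submodule 𝕜 E)
    (hW : IsClosed (W : Set E)) :
    IsClosed ((W.map U.toLinearMap : Submodule 𝕜 E) : Set E) :=
  ((LinearIsometry.isComplete_map_iff U).mpr hW.isComplete).isClosed

/-- For a linear isometry `U` commuting with every `ρ g`, the restriction of `U` is an isometric
isomorphism `W ≃ₗᵢ U(W)` intertwining `ρ|_W` with `ρ|_{U(W)}` («R(g) maps a copy of π to a copy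
of π»). -/
theorem exists_linearIsometryEquiv_map_of_comm {ι : Type*} (U : E →ₗᵢ[𝕜] E) (ρ : ι → E →L[𝕜] E)
    (hU : ∀ g x, U (ρ g x) = ρ g (U x)) (W : Submodule 𝕜 E) :
    ∃ V : W ≃ₗᵢ[𝕜] W.map U.toLinearMap,
      (∀ w : W, (V w : E) = U w) ∧ ∀ (g : ι) (w : W) (hw : ρ g w ∈ W),
        (V ⟨ρ g w, hw⟩ : E) = ρ g (V w : E) := by
  have hrange : LinearMap.range (U.comp W.subtypeₗᵢ).toLinearMap = W.map U.toLinearMap := by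
    ext y
    constructor
    · rintro ⟨w, rfl⟩
      exact ⟨w, w.2, rfl⟩
    · rintro ⟨w, hw, rfl⟩
      exact ⟨⟨w, hw⟩, rfl⟩
  refine ⟨(U.comp W.subtypeₗᵢ).equivRange.trans (LinearIsometryEquiv.ofEq _ _ hrange), ?_, ?_⟩
  · intro w
    simp
  · intro g w hw
    simp [hU]
end Summit.Ventures.HodgeRepro2.T5IsotypicHilbertSum
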